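import Summits.QuantumFields.YangMills.Theorems.BalabanUVNodesN07Row110AtRecord
import Summits.QuantumFields.YangMills.Theorems.BalabanUVNodesN07DeltaPiOfRecordPairing
import Summits.QuantumFields.YangMills.Theorems.BalabanUVNodesN07LieTokAtOfRecordTwo
import Literature.MathematicalPhysics.QuantumFieldTheory.Balaban1983to89.B11Eq80CurrentZpow
import HarnessLib

/-!
# N07 at the record — [15] (81) ⟹ (84): the DERIVATIVE row of the (min) ∧ (c→s) knit from a displayed VALUE identity — print's expansion
# `𝔉(A′) = A(U₀) + ⟨A′, J⟩ + ½⟨A′, Δ₁A′⟩ + V(A′)` (81) read at the record's letters on the real slice — by calculus along real lines: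
# the `J`- and `Δ₁`-terms elementary, the `V`-term by lit's (63) certificate ✓`pair27_W80` (`W = (δ∕δA′)V`), HYPOTHESIS-FREE at the record

Cell `pub-ymgap`, seat `pub-ymgap-dag-n07-w3` (g29, WIDTH SEAT 3 on N07 [B11] = [15]); helper file keyed `--kind proof --supports stmt-QuantumFields-27238 --as helper` (K0ᴬ road);
count-neutral.  INTENT-5 of the seat.

## Why

After ✓`N07Row110AtRecord` ∕ ✓`N07KnitTokensLandauTwo` the knit tokens (min) ∧ (c→s) rest on ONE displayed row: (84) at the record, a DERIVATIVE statement
`HasDerivAt (t ↦ A^η(S.chartLin T V (A + t•δ))) (c·ℜ(⟪ιδ, Ĵ⟫ + ⟪ιδ, Δ₁ ι(A+𝔄V)⟫ + ⟪ιδ, (W(A+𝔄V))^⟫)) 0`.  Expansion files produce VALUE identities ((26) at objects: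
n07-w1 ✓`wilsonAction4_expChart_expansion_hessOpAt`; (81) abstract: lit ✓`B11Eq81Expansion.eq81`).  This file does the calculus once: from the VALUE identity (81) at the record — with
`V := V80` (lit's (80) functional) at EXACTLY the slots of def-Y's `WOfRecordAt = W80 …` — it derives the (84)-row, so that the residual displayed obligation of the knit becomes
print's (81) verbatim: «`A^η(S.chartLin T V (A′ − 𝔄V)) = a₀ + c·ℜ(⟪ιA′, Ĵ⟫ + ½⟪ιA′, Δ₁ ιA′⟫ + V80(A′))` on the real slice ball».

## What is here

* §1 ★ `inner_iota_eq_pair27` — the PAIRING IDENTIFICATION: for a Hermitian-presented jet `δ` and any current `K`, `⟪ιδ, K̂⟫ = pair27 τRec K (flat115 δ)` EXACTLY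
  (both are `η^d Σ_b tr(K(b)δ(b))`: lit ✓`inner_eq_tpair_starW` + ✓`inner_phiRec_symm` + ✓`pair27_eq_sum`) — so the `L²`-read rows of this lineage ARE print's (27)-pairing on the real slice.
* §2 line calculus on the real slice: `hasDerivAt_re_inner_line` (the `J`-term), `hasDerivAt_re_inner_quad_line` (the `Δ₁`-term, `Δ₁` symmetric),
  ★★ `hasDerivAt_re_V80_line` (the `V`-term: `d∕dt ℜ V80(A′ + tδ)|₀ = ℜ(pair27 τRec (W A′) (flat115 δ))`, from ✓`pair27_W80` — its binders `hρ hτ hd hΔ` DISCHARGED at the record by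
  ✓`tauRecCLM_rhoRec_mul`, ✓`tauRecCLM_mul_comm`, ✓`T4Family.P_d`, ✓`DeltaPiCurOfRecord_pair27_comm`; only the Sect. C rows `RC`, `Prop4Hyp C^{sl}` displayed — plus differentiability of `V80`
  along the line, rebuilt from lit ✓`analyticOnNhd_Emap` ∕ ✓`analyticOnNhd_E3` ∕ ✓`differentiable_V0` ∕ ✓`differentiableOn_T47`).
* §3 ★★★ `row84_of_eq81` — at the frame-free scheme of record (slot (c), any `N`, any slot `T`): the VALUE identity (81) on `{A′ ∈ evHerm0 | ‖A′‖ < ρ₁}` (`ρ₁ ≤ a_C`) + `Δ₁` symmetric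
  (def-Y's `HessSymmTok` shape, for `hessOpOfRecord128`) + `RC`, `hC` ⟹ the (84)-row of ✓`minTokens_ofRecord_landau_of_row84` for every `A ∈ Kc^L_ρ V` (`ρ ≤ ρ₁`), `δ ∈ (102) ∩ evHerm0`.

## Honest labels

Calculus + finite-dimensional bookkeeping on CONSTRUCTED letters; displayed: the VALUE identity (81) at the record (NOT proved — [15] (26)+(47)+(78)–(80) at the record's letters, the
N07 expansion programme), the symmetry of `hessOpOfRecord128` (def-Y's `HessSymmTok` territory), the Sect. C rows `RC` ∕ `hC`.  Nothing of Bałaban's estimates proved; K0ᴬ ⟨27238⟩ NOT closed;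
N07 NOT discharged; COUNT∕K UNMOVED; R4 is the conditional finite-𝕋⁴ rung `BalabanLadder.UV` only; finite torus at fixed `ε` — nothing continuum ∕ OS ∕ Clay.  **The Yang–Mills mass gap is
NOT proved by any of this.**  No `sorry`, no `def`, no `instance ∕ notation ∕ set_option`; standard axioms.
[cite: Balaban1985Variational, (27) p.282, (63) p.287, (78)–(84) p.290, Prop. 4 p.292; Balaban1985BackgroundPropagators, (3.11) p.392, (3.119) p.419]
-/

noncomputable section

open Set Metric Filter Topology
open scoped Matrix Matrix.Norms.L2Operator InnerProductSpace ComplexConjugate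

namespace Summit.QuantumFields.YangMills.Theorems.N07Row84OfEq81AtRecord

open Literature.MathematicalPhysics.QuantumFieldTheory.Balaban1983to89
open Literature.MathematicalPhysics.QuantumFieldTheory.Balaban1983to89.T4Continuum (T4Family)
open Literature.MathematicalPhysics.QuantumFieldTheory.Balaban1983to89.Node00
open B9Eq311L2Pairing (WL2)
open B9Eq311TracePairing (starW tpair tpair_def inner_eq_tpair_starW apply_equiv_starW)
open B11Eq103H1Complex (SiteL2K BondL2K funEquiv funEquiv_symm_apply)
open B11Eq111FrakG (nabla115)
open B11Eq115Space (NegSize NegSup JetSup)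
open B11Eq174Chart (Regime)
open B11Prop6Scheme (Prop4Hyp mapT)
open B11Eq90Transpose (pair27 pair27_eq_sum)
open B11Eq90V0primeCurrent (flat115 flat115_apply)
open B11Eq80Current (V80 W80 pair27_W80)

/-! ## §1  The pairing identification on the real slice -/

section Pairing

variable (F : T4Family) (N : ℕ) {K : ℕ} (k : ℕ) (Ω : ℕ → Set (Site (F.P K) 0)) (U₀ : GaugeField (F.P K) 0 (SU N))
  [Fact (0 < (F.L : ℝ))] [Fact (0 < (F.P K).eta k)] [Fact (0 < c0Rec F K k)]
  (ι : Space115Lit F N K k Ω U₀ ≃ₗ[ℂ] BondL2K ℂ (F.P K).d (fun _ => (F.P K).sitesPerDir 0) (c0Rec F K k) (WRec N))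
  (hι : ∀ y, ι y = (funEquiv (phiRec N) (fun _ : B9SectCLatticeCarrier.Bond (F.P K).d (fun _ => (F.P K).sitesPerDir 0) => c0Rec F K k)).symm
    (JetSup.equiv _ _ (nabla115 ((F.P K).eta k) (unitsOfRecord F N U₀)) y))

include hι in
/-- ★ **THE PAIRING IDENTIFICATION**: for a jet `δ` whose presented field is Hermitian at every bond and ANY current `K`, the `L²` pairing of the canonical readings
equals print's (27)-pairing: `⟪ιδ, K̂⟫ = pair27 τRec K (flat115 δ)` (`= η^d Σ_b tr(K(b)δ(b))`; `⟨φ⁻¹X, φ⁻¹Y⟩ = tr(X⋆Y)`, cyclicity of the trace).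
[cite: Balaban1985Variational, (27) p.282; Balaban1985BackgroundPropagators, (3.11) p.392] -/
theorem inner_iota_eq_pair27 {δ : Space115Lit F N K k Ω U₀}
    (hδ : ∀ b, star (JetSup.equiv _ _ (nabla115 ((F.P K).eta k) (unitsOfRecord F N U₀)) δ b) = JetSup.equiv _ _ (nabla115 ((F.P K).eta k) (unitsOfRecord F N U₀)) δ b)
    (K' : NegSizeLit F N K k Ω 3) :
    ⟪ι δ, (funEquiv (phiRec N) (fun _ : B9SectCLatticeCarrier.Bond (F.P K).d (fun _ => (F.P K).sitesPerDir 0) => c0Rec F K k)).symm (NegSup.equiv _ _ K')⟫_ℂ =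
      pair27 (tauRecCLM N) K' (flat115 δ) := by
  rw [hι, inner_eq_tpair_starW (phiRec N) (tauRec N) inner_phiRec_symm, tpair_def, pair27_eq_sum, Finset.mul_sum]
  refine Finset.sum_congr rfl fun b _ => ?_
  rw [apply_equiv_starW, funEquiv_symm_apply, funEquiv_symm_apply, LinearEquiv.apply_symm_apply, LinearEquiv.apply_symm_apply, hδ b, flat115_apply,
    tauRecCLM_apply]
  have hc0 : ((c0Rec F K k : ℝ) : ℂ) = (((F.P K).eta k : ℝ) : ℂ) ^ (F.P K).d := by
    rw [c0Rec]; push_cast; rfl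
  rw [hc0, Matrix.traceLinearMap_apply, Matrix.trace_mul_comm]

end Pairing


/-! ## §2  Line calculus on the real slice -/

section LineCalculus

variable {E : Type*} [NormedAddCommGroup E] [InnerProductSpace ℂ E]

/-- The `J`-term along a real line: `d∕dt ℜ⟪x₀ + t v, y⟫ = ℜ⟪v, y⟫`. [cite: Balaban1985Variational, (84) p.290 (bookkeeping)] -/
theorem hasDerivAt_re_inner_affine (x₀ v y : E) :
    HasDerivAt (fun t : ℝ => RCLike.re ⟪x₀ + (t : ℂ) • v, y⟫_ℂ) (RCLike.re ⟪v, y⟫_ℂ) 0 := by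
  have e : (fun t : ℝ => RCLike.re ⟪x₀ + (t : ℂ) • v, y⟫_ℂ) = fun t : ℝ => RCLike.re ⟪x₀, y⟫_ℂ + t * RCLike.re ⟪v, y⟫_ℂ := by
    funext t
    rw [inner_add_left, inner_smul_left, Complex.conj_ofReal]
    simp only [RCLike.re_to_complex, Complex.add_re, Complex.re_ofReal_mul]
  rw [e]
  exact (((hasDerivAt_id (0 : ℝ)).mul_const (RCLike.re ⟪v, y⟫_ℂ)).const_add (RCLike.re ⟪x₀, y⟫_ℂ)).congr_deriv (one_mul _)

/-- The `Δ₁`-term along a real line, `Δ₁` symmetric: `d∕dt ℜ⟪x₀ + t v, Δ₁(x₀ + t v)⟫|₀ = 2ℜ⟪v, Δ₁x₀⟫`. [cite: Balaban1985Variational, (84) p.290 (bookkeeping), p.293] -/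
theorem hasDerivAt_re_inner_quad_affine (T : E →ₗ[ℂ] E) (hT : ∀ a b : E, ⟪T a, b⟫_ℂ = ⟪a, T b⟫_ℂ) (x₀ v : E) :
    HasDerivAt (fun t : ℝ => RCLike.re ⟪x₀ + (t : ℂ) • v, T (x₀ + (t : ℂ) • v)⟫_ℂ) (2 * RCLike.re ⟪v, T x₀⟫_ℂ) 0 := by
  have hsym : (⟪x₀, T v⟫_ℂ).re = (⟪v, T x₀⟫_ℂ).re := by
    rw [← hT, ← inner_conj_symm, Complex.conj_re]
  have e : (fun t : ℝ => RCLike.re ⟪x₀ + (t : ℂ) • v, T (x₀ + (t : ℂ) • v)⟫_ℂ) =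
      fun t : ℝ => RCLike.re ⟪x₀, T x₀⟫_ℂ + t * (2 * RCLike.re ⟪v, T x₀⟫_ℂ) + t ^ 2 * RCLike.re ⟪v, T v⟫_ℂ := by
    funext t
    rw [map_add, map_smul, inner_add_left, inner_add_right, inner_add_right, inner_smul_left, inner_smul_left, inner_smul_right, inner_smul_right,
      Complex.conj_ofReal]
    simp only [RCLike.re_to_complex, Complex.add_re, Complex.re_ofReal_mul, ← mul_assoc]
    rw [hsym, show ((t : ℂ) * (t : ℂ)) = (((t * t : ℝ)) : ℂ) by push_cast; ring, Complex.re_ofReal_mul]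
    ring
  rw [e]
  have h1 := ((hasDerivAt_id (0 : ℝ)).mul_const (2 * RCLike.re ⟪v, T x₀⟫_ℂ)).const_add (RCLike.re ⟪x₀, T x₀⟫_ℂ)
  have h2 := (hasDerivAt_pow 2 (0 : ℝ)).mul_const (RCLike.re ⟪v, T v⟫_ℂ)
  exact (h1.add h2).congr_deriv (by simp)

end LineCalculus

/-! ## §3  The `V`-term at the record: lit's (63) certificate along a real line, and the assembly (81) ⟹ (84) -/

section Record

variable (F : T4Family) (N : ℕ) [NeZero N] {K : ℕ} (k : ℕ) (Ω : ℕ → Set (Site (F.P K) 0)) (U₀ : GaugeField (F.P K) 0 (SU N))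
  [Fact (0 < (F.L : ℝ))] [Fact (0 < (F.P K).eta k)] (levB : PBond (F.P K) k → ℕ) [Fact (0 < c0Rec F K k)] [Fact (∀ c, 0 < wBRec F K k c)] (a : ℝ)
  (hposb : ∀ x, x ≠ 0 → 0 < RCLike.re ⟪x, laplaceAOfRecord F N k U₀ (QOfRecord F N k U₀) (QflatOfRecord F N k) a x⟫_ℂ)
  (hQ : Function.Surjective (QOfRecord F N k U₀)) (εC : ℝ)
  (Gp : SiteL2K ℂ (F.P K).d (fun _ => (F.P K).sitesPerDir 0) (c0Rec F K k) (WRec N) →ₗ[ℂ]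
    SiteL2K ℂ (F.P K).d (fun _ => (F.P K).sitesPerDir 0) (c0Rec F K k) (WRec N))
  (Δ2 : BondL2K ℂ (F.P K).d (fun _ => (F.P K).sitesPerDir 0) (c0Rec F K k) (WRec N) →ₗ[ℂ]
    BondL2K ℂ (F.P K).d (fun _ => (F.P K).sitesPerDir 0) (c0Rec F K k) (WRec N))
  (hposπ : ∀ x, x ≠ 0 → 0 < RCLike.re ⟪x, laplaceAOfRecordAt F N k U₀ (hessOpOfRecord128 F N k U₀ Gp (QflatOfRecord F N k) Δ2)
    (QOfRecord F N k U₀) (QflatOfRecord F N k) a x⟫_ℂ)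
  {b C₂ c₄ aC : ℝ}
  (RC : Regime (H1OfRecordAtBgFlat F N K k Ω U₀ levB a hposb hQ) 0 (CslOfRecord F N K k Ω U₀ levB) b 0 C₂ c₄ 0 aC εC)
  (hC : Prop4Hyp (CslOfRecord F N K k Ω U₀ levB) C₂ c₄)
  (ι : Space115Lit F N K k Ω U₀ ≃ₗ[ℂ] BondL2K ℂ (F.P K).d (fun _ => (F.P K).sitesPerDir 0) (c0Rec F K k) (WRec N))
  (hι : ∀ y, ι y = (funEquiv (phiRec N) (fun _ : B9SectCLatticeCarrier.Bond (F.P K).d (fun _ => (F.P K).sitesPerDir 0) => c0Rec F K k)).symm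
    (JetSup.equiv _ _ (nabla115 ((F.P K).eta k) (unitsOfRecord F N U₀)) y))

include RC hC in
/-- ★★ **THE `V`-TERM: `d∕dt ℜV(A′ + tδ)|₀ = ℜ⟨W(A′), δ⟩` ALONG A REAL LINE**, `V := V80Z` (lit's (80) functional, integer-power `V₀`; = `V80` at `d = 4`) at EXACTLY the slots of
def-Y's `WOfRecordAt = W80 …` — lit ✓`hasDerivAt_V80Z_line_real` with its binders DISCHARGED at the record: `hρ` ✓`tauRecCLM_rhoRec_mul`, `hτ` ✓`tauRecCLM_mul_comm`, `hΔ`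
✓`DeltaPiCurOfRecord_pair27_comm`; displayed: the Sect. C rows `RC`, `hC`, and `‖A′‖ < a_C`. [cite: Balaban1985Variational, (63) p.287, (80) p.290, (84) p.290] -/
theorem hasDerivAt_re_V80Z_line {A' : Space115Lit F N K k Ω U₀} (hA' : ‖A'‖ < aC) (δ : Space115Lit F N K k Ω U₀) :
    HasDerivAt (fun t : ℝ => RCLike.re (B11Eq80CurrentZpow.V80Z (tauRecCLM N) (unitsOfRecord F N U₀) (H1OfRecordAtBgFlat F N K k Ω U₀ levB a hposb hQ)
        (CslOfRecord F N K k Ω U₀ levB) εC (JOfRecordAtBg F N K k Ω U₀) (DeltaPiCurOfRecord F N K k Ω U₀ Gp (QflatOfRecord F N k)) (A' + (t : ℂ) • δ)))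
      (RCLike.re (pair27 (tauRecCLM N) (WOfRecordAt F N K k Ω U₀ levB a hposb hQ εC Gp A') (flat115 δ))) 0 := by
  have h := B11Eq80CurrentZpow.hasDerivAt_V80Z_line_real (tauRecCLM_rhoRec_mul N) (tauRecCLM_mul_comm N) (unitsOfRecord F N U₀) RC hC
    (JOfRecordAtBg F N K k Ω U₀) (N07DeltaPiOfRecordPairing.DeltaPiCurOfRecord_pair27_comm F N k U₀ Ω Gp (QflatOfRecord F N k)) hA' δ
  have h' := (Complex.reCLM.hasFDerivAt.comp_hasDerivAt (0 : ℝ) h)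
  simp only [Function.comp_def, Complex.reCLM_apply] at h'
  simp only [RCLike.re_to_complex]
  exact h'

include hι RC hC in
/-- ★★★ **(81) ⟹ (84) AT THE RECORD.**  At the frame-free scheme of record (slot (c), any `N`, any slot `T`) fix `V`, a radius `ρ₁ ≤ a_C`, and suppose: the VALUE identity (81) on the
real slice ball — for every `A′ ∈ evHerm0` with `‖A′‖ < ρ₁`, `A^η(S.chartLin T V (A′ − 𝔄V)) = a₀ + c·(ℜ⟪ιA′, Ĵ⟫ + ½ℜ⟪ιA′, Δ₁ ιA′⟫ + ℜ V80Z(A′))` (`Δ₁ = π†(Δ(U₀) + Δ⁽²⁾)π`,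
`V80Z` at `WOfRecordAt`'s slots) — and `Δ₁` symmetric.  THEN the (84)-row of ✓`minTokens_ofRecord_landau_of_row84` holds at every `A` of the Landau family `Kc^L_ρ V` (`ρ ≤ ρ₁`) and
every real tangent direction `δ ∈ (102) ∩ evHerm0`: `HasDerivAt (t ↦ A^η(S.chartLin T V (A + t•δ))) (c·ℜ(⟪ιδ, Ĵ⟫ + ⟪ιδ, Δ₁ ι(A+𝔄V)⟫ + ⟪ιδ, (W(A+𝔄V))^⟫)) 0`.
[cite: Balaban1985Variational, (81)–(84) p.290, (63) p.287, (27) p.282] -/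
theorem row84_of_eq81 (hsym : ∀ x y, ⟪hessOpOfRecord128 F N k U₀ Gp (QflatOfRecord F N k) Δ2 x, y⟫_ℂ = ⟪x, hessOpOfRecord128 F N k U₀ Gp (QflatOfRecord F N k) Δ2 y⟫_ℂ)
    (dom : Set (GaugeField (F.P K) k (SU N))) (B₀ C₄ a₃ j a𝔄 ε₄ : ℝ)
    (T : GaugeField (F.P K) k (SU N) → Space115Lit F N K k Ω U₀ → Space115Lit F N K k Ω U₀) (V : GaugeField (F.P K) k (SU N))
    {ρ ρ₁ : ℝ} (hρ : ρ ≤ ρ₁) (hρ₁ : ρ₁ ≤ aC) (a₀ c : ℝ)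
    (eq81 : ∀ A' : Space115Lit F N K k Ω U₀,
      A' ∈ (bgSchemeOfRecord F N K k Ω U₀ dom levB Gp Δ2 a hposπ hposb hQ εC B₀ C₄ a₃ j a𝔄 ε₄).evHerm0 → ‖A'‖ < ρ₁ →
      wilsonAction4 ((bgSchemeOfRecord F N K k Ω U₀ dom levB Gp Δ2 a hposπ hposb hQ εC B₀ C₄ a₃ j a𝔄 ε₄).chartLin T V
          (A' - frakAOfRecordAtBg128 F N K k Ω U₀ levB Gp Δ2 a hposπ hQ V)) =
        a₀ + c * (RCLike.re ⟪ι A', (funEquiv (phiRec N) (fun _ : B9SectCLatticeCarrier.Bond (F.P K).d (fun _ => (F.P K).sitesPerDir 0) => c0Rec F K k)).symm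
            (NegSup.equiv _ _ (JOfRecordAtBg F N K k Ω U₀))⟫_ℂ +
          2⁻¹ * RCLike.re ⟪ι A', hessOpOfRecord128 F N k U₀ Gp (QflatOfRecord F N k) Δ2 (ι A')⟫_ℂ +
          RCLike.re (B11Eq80CurrentZpow.V80Z (tauRecCLM N) (unitsOfRecord F N U₀) (H1OfRecordAtBgFlat F N K k Ω U₀ levB a hposb hQ)
            (CslOfRecord F N K k Ω U₀ levB) εC (JOfRecordAtBg F N K k Ω U₀) (DeltaPiCurOfRecord F N K k Ω U₀ Gp (QflatOfRecord F N k)) A'))) :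
    ∀ A ∈ {A : Space115Lit F N K k Ω U₀ | A ∈ constraint102OfRecord F N K k Ω U₀ ∧
        A + frakAOfRecordAtBg128 F N K k Ω U₀ levB Gp Δ2 a hposπ hQ V ∈ (bgSchemeOfRecord F N K k Ω U₀ dom levB Gp Δ2 a hposπ hposb hQ εC B₀ C₄ a₃ j a𝔄 ε₄).evHerm0 ∧
        ‖A + frakAOfRecordAtBg128 F N K k Ω U₀ levB Gp Δ2 a hposπ hQ V‖ < ρ},
      ∀ δ ∈ {δ : Space115Lit F N K k Ω U₀ | δ ∈ constraint102OfRecord F N K k Ω U₀ ∧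
        δ ∈ (bgSchemeOfRecord F N K k Ω U₀ dom levB Gp Δ2 a hposπ hposb hQ εC B₀ C₄ a₃ j a𝔄 ε₄).evHerm0},
      HasDerivAt (fun t : ℝ => wilsonAction4 ((bgSchemeOfRecord F N K k Ω U₀ dom levB Gp Δ2 a hposπ hposb hQ εC B₀ C₄ a₃ j a𝔄 ε₄).chartLin T V (A + t • δ)))
        (c * RCLike.re
          (⟪ι δ, (funEquiv (phiRec N) (fun _ : B9SectCLatticeCarrier.Bond (F.P K).d (fun _ => (F.P K).sitesPerDir 0) => c0Rec F K k)).symm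
              (NegSup.equiv _ _ (JOfRecordAtBg F N K k Ω U₀))⟫_ℂ +
            ⟪ι δ, hessOpOfRecord128 F N k U₀ Gp (QflatOfRecord F N k) Δ2 (ι (A + frakAOfRecordAtBg128 F N K k Ω U₀ levB Gp Δ2 a hposπ hQ V))⟫_ℂ +
            ⟪ι δ, (funEquiv (phiRec N) (fun _ : B9SectCLatticeCarrier.Bond (F.P K).d (fun _ => (F.P K).sitesPerDir 0) => c0Rec F K k)).symm
              (NegSup.equiv _ _ (WOfRecordAt F N K k Ω U₀ levB a hposb hQ εC Gp (A + frakAOfRecordAtBg128 F N K k Ω U₀ levB Gp Δ2 a hposπ hQ V)))⟫_ℂ)) 0 := by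
  intro A hA δ hδ
  obtain ⟨-, hAherm, hAlt⟩ := hA
  obtain ⟨-, hδherm⟩ := hδ
  set A' := A + frakAOfRecordAtBg128 F N K k Ω U₀ levB Gp Δ2 a hposπ hQ V with hA'def
  have hA'aC : ‖A'‖ < aC := lt_of_lt_of_le hAlt (hρ.trans hρ₁)
  -- δ is Hermitian-presented
  have hδstar : ∀ bb, star (JetSup.equiv _ _ (nabla115 ((F.P K).eta k) (unitsOfRecord F N U₀)) δ bb) =
      JetSup.equiv _ _ (nabla115 ((F.P K).eta k) (unitsOfRecord F N U₀)) δ bb :=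
    (N07LieTokAtOfRecordTwo.conjJet_eq_self_iff F N K k Ω U₀ δ).1
      ((N07LieTokAtOfRecordTwo.mem_evHerm0_ofRecord_iff F N K k Ω U₀ dom levB Gp Δ2 a hposπ hposb hQ εC B₀ C₄ a₃ j a𝔄 ε₄ δ).1 hδherm).1
  -- (81) holds along the line for small real t
  have hnhds : {t : ℝ | ‖A' + (t : ℂ) • δ‖ < ρ₁} ∈ 𝓝 (0 : ℝ) := by
    refine IsOpen.mem_nhds ?_ ?_
    · exact isOpen_lt ((continuous_const.add (Complex.continuous_ofReal.smul continuous_const)).norm) continuous_const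
    · show ‖A' + ((0 : ℝ) : ℂ) • δ‖ < ρ₁
      simpa using lt_of_lt_of_le hAlt hρ
  have hEq : (fun t : ℝ => wilsonAction4 ((bgSchemeOfRecord F N K k Ω U₀ dom levB Gp Δ2 a hposπ hposb hQ εC B₀ C₄ a₃ j a𝔄 ε₄).chartLin T V (A + t • δ))) =ᶠ[𝓝 0]
      fun t : ℝ => a₀ + c * (RCLike.re ⟪ι (A' + (t : ℂ) • δ), (funEquiv (phiRec N) (fun _ : B9SectCLatticeCarrier.Bond (F.P K).d (fun _ => (F.P K).sitesPerDir 0) => c0Rec F K k)).symm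
            (NegSup.equiv _ _ (JOfRecordAtBg F N K k Ω U₀))⟫_ℂ +
          2⁻¹ * RCLike.re ⟪ι (A' + (t : ℂ) • δ), hessOpOfRecord128 F N k U₀ Gp (QflatOfRecord F N k) Δ2 (ι (A' + (t : ℂ) • δ))⟫_ℂ +
          RCLike.re (B11Eq80CurrentZpow.V80Z (tauRecCLM N) (unitsOfRecord F N U₀) (H1OfRecordAtBgFlat F N K k Ω U₀ levB a hposb hQ)
            (CslOfRecord F N K k Ω U₀ levB) εC (JOfRecordAtBg F N K k Ω U₀) (DeltaPiCurOfRecord F N K k Ω U₀ Gp (QflatOfRecord F N k)) (A' + (t : ℂ) • δ))) := by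
    filter_upwards [hnhds] with t ht
    have hmem : A' + (t : ℂ) • δ ∈ (bgSchemeOfRecord F N K k Ω U₀ dom levB Gp Δ2 a hposπ hposb hQ εC B₀ C₄ a₃ j a𝔄 ε₄).evHerm0 := by
      rw [Complex.coe_smul]; exact add_mem hAherm (Submodule.smul_mem _ t hδherm)
    have h81 := eq81 _ hmem ht
    have hsub : A' + (t : ℂ) • δ - frakAOfRecordAtBg128 F N K k Ω U₀ levB Gp Δ2 a hposπ hQ V = A + t • δ := by
      rw [hA'def, Complex.coe_smul]; abel
    rw [hsub] at h81
    exact h81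
  -- derivative of the right-hand side
  have hlin : ∀ t : ℝ, ι (A' + (t : ℂ) • δ) = ι A' + (t : ℂ) • ι δ := fun t => by rw [map_add, map_smul]
  have hJ := hasDerivAt_re_inner_affine (ι A') (ι δ)
    ((funEquiv (phiRec N) (fun _ : B9SectCLatticeCarrier.Bond (F.P K).d (fun _ => (F.P K).sitesPerDir 0) => c0Rec F K k)).symm (NegSup.equiv _ _ (JOfRecordAtBg F N K k Ω U₀)))
  have hQd := hasDerivAt_re_inner_quad_affine (hessOpOfRecord128 F N k U₀ Gp (QflatOfRecord F N k) Δ2) hsym (ι A') (ι δ)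
  have hV := hasDerivAt_re_V80Z_line F N k Ω U₀ levB a hposb hQ εC Gp RC hC hA'aC δ
  have hsum := ((hJ.add (hQd.const_mul (2⁻¹ : ℝ))).add hV).const_mul c |>.const_add a₀
  have hsum' : HasDerivAt (fun t : ℝ => a₀ + c * (RCLike.re ⟪ι (A' + (t : ℂ) • δ), (funEquiv (phiRec N) (fun _ : B9SectCLatticeCarrier.Bond (F.P K).d (fun _ => (F.P K).sitesPerDir 0) => c0Rec F K k)).symm
            (NegSup.equiv _ _ (JOfRecordAtBg F N K k Ω U₀))⟫_ℂ +
          2⁻¹ * RCLike.re ⟪ι (A' + (t : ℂ) • δ), hessOpOfRecord128 F N k U₀ Gp (QflatOfRecord F N k) Δ2 (ι (A' + (t : ℂ) • δ))⟫_ℂ +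
          RCLike.re (B11Eq80CurrentZpow.V80Z (tauRecCLM N) (unitsOfRecord F N U₀) (H1OfRecordAtBgFlat F N K k Ω U₀ levB a hposb hQ)
            (CslOfRecord F N K k Ω U₀ levB) εC (JOfRecordAtBg F N K k Ω U₀) (DeltaPiCurOfRecord F N K k Ω U₀ Gp (QflatOfRecord F N k)) (A' + (t : ℂ) • δ))))
      (c * (RCLike.re ⟪ι δ, (funEquiv (phiRec N) (fun _ : B9SectCLatticeCarrier.Bond (F.P K).d (fun _ => (F.P K).sitesPerDir 0) => c0Rec F K k)).symm (NegSup.equiv _ _ (JOfRecordAtBg F N K k Ω U₀))⟫_ℂ +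
        2⁻¹ * (2 * RCLike.re ⟪ι δ, hessOpOfRecord128 F N k U₀ Gp (QflatOfRecord F N k) Δ2 (ι A')⟫_ℂ) +
        RCLike.re (pair27 (tauRecCLM N) (WOfRecordAt F N K k Ω U₀ levB a hposb hQ εC Gp A') (flat115 δ)))) 0 := by
    refine hsum.congr_of_eventuallyEq (Filter.Eventually.of_forall fun t => ?_)
    simp only [hlin, Pi.add_apply]
  -- the pairing identification for the `W`-term and the assembly
  have hW := inner_iota_eq_pair27 F N k Ω U₀ ι hι hδstar (WOfRecordAt F N K k Ω U₀ levB a hposb hQ εC Gp A')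
  refine (hsum'.congr_of_eventuallyEq hEq).congr_deriv ?_
  simp only [RCLike.re_to_complex, Complex.add_re]
  rw [hW]
  ring

end Record

end Summit.QuantumFields.YangMills.Theorems.N07Row84OfEq81AtRecord

end
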